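import Literature.IUT.HodgeArakelov.LabelClassesOfCuspsR2Proofs
import HarnessLib

/-!
# [IUTchII] Rmk 2.4.1: «every closed subgroup of such a maximal pro-`l′` subgroup is either open or trivial» — for ANY subgroup
# topologically isomorphic to `ℤ_{l′}` (proof-only closer)

S. Mochizuki, *Inter-universal Teichmüller Theory II*, kurims manuscript (Dec. 2020), §2, Remark 2.4.1, p. 71: «one may replace “`I_t`” in
Corollary 2.4 by its maximal pro-`l′` subgroup for any `l′ ∈ 𝔓𝔯𝔦𝔪𝔢𝔰 \ {p_v}`. The use of such maximal pro-`l′` subgroups sometimes results in a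
simplification …, since every closed subgroup of such a maximal pro-`l′` subgroup is either open or trivial.»  ([IUTchII] Rmk 2.4.1, kurims p.71)
[cite: Mochizuki2012, II Rmk 2.4.1 p.71] [claim: Mochizuki2012, status: disputed] (D-0012 claim key; this file is classical profinite group theory
about `ℤ_{l′}`, nothing of the series is asserted).  abc-iut cell, node **IUTchII:Rmk2.4.1** (zone [IUTchII] §2; seat abc-iut-L6-t19 gen 6), PROOF-ONLY
companion of the repair file `LabelClassesOfCuspsR2.lean` (p408509: the statement of record `Rmk241_openOrTrivial'`) and of
`LabelClassesOfCuspsR2Proofs.lean` (p410103: the case `I′ = ℤ_p` itself, `rmk241_openOrTrivial'_padicInt`).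

THE POINT.  p410103 proves the printed dichotomy only for `I′ = ⊤ ≤ ℤ_p`.  Print's `I′` is «the maximal pro-`l′` subgroup of `I_t`» — a closed
subgroup of `Π̂^cor_v` abstractly isomorphic, AS A TOPOLOGICAL GROUP, to `ℤ_{l′}` (since `I_t ≅ Ẑ(1)`).  This file transports the dichotomy along any
such isomorphism:

* **`rmk241_openOrTrivial'_of_continuousMulEquiv_padicInt`** — for every topological group `G`, every subgroup `I′ ≤ G` and every isomorphism of
  topological groups `e : I′ ≃ₜ* ℤ_{l′}` (multiplicatively written): `Rmk241_openOrTrivial' I′`, i.e. every subgroup `K ≤ I′` CLOSED in `G` is trivial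
  or of finite index in `I′` (push `K` to `ℤ_{l′}` along the homeomorphism `e`, apply p410103, pull back: `⊥` and the index are preserved by `e`).

Nothing here takes a side on [IUTchIII] Cor 3.12; typed ≠ proved for the series' claims.
-/

namespace Literature.IUT.HodgeArakelov

universe u

/-- **IUTchII:Rmk2.4.1′ for every copy of `ℤ_{l′}`** (kurims p. 71): if `I′ ≤ G` is isomorphic as a topological group to `ℤ_{l′}` (written
multiplicatively), then every subgroup `K ≤ I′` that is closed in `G` is trivial or of finite index in `I′` — the statement of record
`Rmk241_openOrTrivial' I′` (abc-iut-L6-t19, p408509), from the case `I′ = ℤ_{l′}` (p410103) transported along `e`.  PROVED.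
([IUTchII] Rmk 2.4.1, kurims p.71) [cite: Mochizuki2012, II Rmk 2.4.1 p.71] [claim: Mochizuki2012, status: disputed] -/
theorem rmk241_openOrTrivial'_of_continuousMulEquiv_padicInt {G : Type u} [Group G] [TopologicalSpace G]
    (I' : Subgroup G) {q : ℕ} [Fact q.Prime] (e : I' ≃ₜ* Multiplicative ℤ_[q]) : Rmk241_openOrTrivial' I' := by
  intro K hK hKc
  -- `K ∩ I'` read in `I'`, closed there, and its image `K'` in `ℤ_q`, closed since `e` is a homeomorphism
  have hc : IsClosed ((K.subgroupOf I' : Subgroup I') : Set I') := hKc.preimage continuous_subtype_val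
  set K' : Subgroup (Multiplicative ℤ_[q]) := (K.subgroupOf I').map e.toMulEquiv.toMonoidHom with hK'def
  have hK'set : (K' : Set (Multiplicative ℤ_[q])) = e '' ((K.subgroupOf I' : Subgroup I') : Set I') := by
    rw [hK'def, Subgroup.coe_map]
    rfl
  have hK'c : IsClosed (K' : Set (Multiplicative ℤ_[q])) := by
    rw [hK'set]
    exact e.toHomeomorph.isClosedMap _ hc
  rcases rmk241_openOrTrivial'_padicInt q K' le_top hK'c with h | h
  · -- `K' = ⊥`, hence `K ∩ I' = ⊥` (`e` injective), hence `K = ⊥` (`K ≤ I'`)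
    left
    have hbot : K.subgroupOf I' = ⊥ := by
      rw [eq_bot_iff]
      intro x hx
      have hx' : e x ∈ K' := ⟨x, hx, rfl⟩
      rw [h, Subgroup.mem_bot] at hx'
      rw [Subgroup.mem_bot]
      exact e.injective (by rw [hx', map_one])
    rw [eq_bot_iff]
    intro g hg
    have hg' : (⟨g, hK hg⟩ : I') ∈ K.subgroupOf I' := Subgroup.mem_subgroupOf.mpr hg
    rw [hbot, Subgroup.mem_bot] at hg'
    rw [Subgroup.mem_bot]
    exact congrArg Subtype.val hg'
  · -- finite index is preserved along the bijection `e`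
    right
    have hidx : (K.subgroupOf I').index = K'.index := by
      rw [hK'def, Subgroup.index_map_of_bijective e.bijective]
    have hK'idx : K'.index ≠ 0 := by
      have h1 : (K'.subgroupOf ⊤).index ≠ 0 := h.index_ne_zero
      change K'.relIndex ⊤ ≠ 0 at h1
      rwa [Subgroup.relIndex_top_right] at h1
    exact ⟨by rw [hidx]; exact hK'idx⟩

end Literature.IUT.HodgeArakelov
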